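import Summits.ResolutionOfSingularities.ResolutionOfSingularities.Theorems.FrobeniusClosingPatchingRelPerfectDepthFlagLegalOldBoundary
import Summits.ResolutionOfSingularities.ResolutionOfSingularities.Theorems.FrobeniusClosingPatchingRelPerfectDepthFlagPrephaseCJS
import Summits.ResolutionOfSingularities.ResolutionOfSingularities.Theorems.FrobeniusClosingPatchingRelPerfectDepthFlagDiagonal
import Literature.AlgebraicGeometry.Resolution.ControlledTransformBaseChange
import Literature.AlgebraicGeometry.Resolution.RegularCentreRsopGenerated
import Literature.AlgebraicGeometry.Resolution.RegularSubschemeLocallyIrreducible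
import Literature.AlgebraicGeometry.Resolution.ArithmeticalThreefoldsBlowupFormDimThree
import Literature.AlgebraicGeometry.Resolution.AlterationsEnlargingZ
import Literature.AlgebraicGeometry.Resolution.AlterationsInduction
import Literature.AlgebraicGeometry.Resolution.DivisorialPartLemmas
import Literature.AlgebraicGeometry.Resolution.HasSNCStrictNormalCrossings
import Summits.ResolutionOfSingularities.ResolutionOfSingularities.Theorems.FrobeniusClosingPatchingRelPerfectDepthWeightTwoBState
import Summits.ResolutionOfSingularities.ResolutionOfSingularities.Theorems.FrobeniusClosingPatchingRelPerfectDepthWeightTwoBPeelLoop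
import HarnessLib

/-!
# Chain W5.2 — F6 stage 1, residual `LegalDivisorReduction₃`: PHASE 2 «reach an snc support» by WEIGHT-TWO TRANSPORT along an
# old-boundary-permissible sequence — CLOSED modulo the F-60♯-shaped binder `OldBoundaryResolution₃`

[OURS · L1 W5.2 · res-D-pv-016 AS res-L1-w52-stub-5, LDR₃ hand #1 = closer (2a) of `LegalPhaseTwo₃` (res-L1-w52-idea-1 OWNER RULING O1.3
2026-08-27T11:55:07Z; res-L1-w52-plan-1 R3a/R3c).]  NOT statements of the manuscript under review; AI-written, weaker than expert
review.  Fact-free kernel work; the ONLY non-kernel input is the explicit hypothesis `(hOB : OldBoundaryResolution₃)`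
(`…DepthFlagLegalOldBoundary`, OURS CONDITIONAL binder — res-dag-4 12:01:38Z (3)).

THE TRANSPORT (`oldBoundary_transport`).  State at stage `j`: the weight-two transform `H_j` (effective Cartier) with the bound
`H_j ≤ 𝓘(closure X_j) · 𝓘(closure Bold_j)` (ideals of the CJS strict transform and of the strict transform of the initial
boundary) and `Supp H_j ⊆ σ⁻¹(Supp H)`.  STEP along `IsOBPermissibleSequence.blowup` at the centre `V(C)`:
* **L2 — legality by ORDER** (`le_sq_of_le_mul_vanishingIdeal`): every point `y` of `V(C)` lies on `closure X_j`
  (`𝓘(closure X_j) ≤ C`) and on `Bold_j` (the old-boundary clause), so `(H_j)_y ≤ 𝔪_y · 𝔪_y`, i.e. `ord_y H_j ≥ 2` at EVERY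
  scheme point of the regular centre, whence `H_j ≤ 𝓘_C²` (`le_pow_of_isRegular_subscheme_of_forall_le_idealOrder_of_isRegular`);
* weight-two step `H_{j+1} := τᶜ(H_j, 2)`, `τ^*H_j = 𝓘_exc² · H_{j+1}` (`IsBlowup.pow_mul_controlledTransform_eq`) — one more
  `IsPureWeightedSeq.cons`; `H_{j+1}` effective Cartier (`isEffectiveCartier_controlledTransform_of_le_pow`);
* the bound transports: `τᶜ(𝓘(X_j)·𝓘(Bold_j), 2) = τᶜ(𝓘(X_j), 1) · τᶜ(𝓘(Bold_j), 1)` (`controlledTransform_mul_two`, both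
  factors `≤ C`) and `τᶜ(𝓘(closure S), 1) ≤ 𝓘(closure τ⁻¹(S ∖ V(C)))` (res-type-049's
  `DepthFlagCJS.controlledTransform_one_le_vanishingIdeal`) for `S = X_j` and `S = Bold_j`;
* `Supp τᶜ(H_j, 2) ⊆ Supp τ^*H_j = τ⁻¹ Supp H_j`; the ambient stays integral / Noetherian / regular / excellent / 3-dimensional
  (`IsBlowup.isIntegral`, `isNoetherian_of_isBlowup`, `IsBlowup.isRegular_of_isRegular_subscheme`, `IsBlowup.isExcellent`,
  `IsModification.isBirational.topologicalKrullDim_eq_of_isProper`).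
No host law, no piece splitting, no snc bookkeeping en route: the snc END comes from the binder's end clause, and
`Supp H_n ⊆ π⁻¹(Supp D ∪ Supp M) = X_n ∪ B_n`.

THE CLOSER (`phaseTwo_sncSupport_of_oldBoundary`, content form of `LegalPhaseTwo₃` = idea-1 O1.3, in res-D-pv-016's ONE-IDEAL
currency): from `HostBoundary₃`-data `H = D·M` (`D` regular effective Cartier host, `Supp M ⊆ B` snc, no host component in `B`) on an
integral Noetherian regular excellent threefold, `H ≠ ⊥` locally principal ⇒ `∃ π H'`, `IsPureWeightedSeq 2 π H H'` with the
threefold clauses, `H' ≠ ⊥` locally principal, and `SncSupport`-data `∃ B' snc ⊇ Supp H'`.  The binder is applied with the OLD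
boundary `:= Supp M` (the POSITIVE-coefficient components only — idea-1 O1.3 (2a); `Supp M` is snc as the support of the effective
Cartier factor `M` inside the snc divisor `B`, de Jong 4.9 = tree `IsStrictNormalCrossingsDivisor.of_subset_of_isEffectiveCartier`).
IN `StateIn` CURRENCY (`phaseTwo_sncSupport_of_stateIn`): idea-1's `HostBoundary₃ E H` (Φ rev 3) is literally
`∃ D ℬ, WeightTwoB.StateIn H D ℬ [] ∧ Scheme.IsRegular D.subscheme` (res-D-pv-054's T5-E state: reduced Cartier host × boundary
monomial `monomialIdeal ℬ`, boundary sheaves `HasSNC` with irreducible supports, none inside the host); the snc boundary SET is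
`⋃ supp` of the boundary sheaves (`HasSNC.isStrictNormalCrossingsDivisor_biUnion_support`), and «no host component in the boundary»
in coheight form is `one_lt_coheight_of_stateIn` (a coheight-`≤ 1` point of `Supp D ∩ Supp F` is the generic point of the
irreducible Cartier support `Supp F`, forcing `Supp F ⊆ Supp D` — the `free` clause).  The by-name one-liner
`legalPhaseTwo₃_of_oldBoundary : OldBoundaryResolution₃ → LegalPhaseTwo₃` (unpack `FlagState₃`/`HostBoundary₃`, apply
`phaseTwo_sncSupport_of_stateIn`, repack) follows in a sibling once idea-1's `…DepthFlagLegalPhases` (decl `LegalPhaseTwo₃`) is in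
the tree.

[cite: CossartJannsenSaito2020, Thm. 1.4, Cor. 6.26, Def. 6.23 (2)] [cite: BierstoneGrigorievMilmanWlodarczyk2011, §3.2 Lemma 3.2.1]
[cite: Kollar2007, 3.30.2] [cite: DeJong1996, 4.9]
-/

-- `Summit.<Summit>.<Sub>.Theorems` with `Sub = Summit` (single-conjunct summit, D-0017)
set_option linter.dupNamespace false

noncomputable section

open CategoryTheory CategoryTheory.Limits AlgebraicGeometry TopologicalSpace IsLocalRing
open Literature.AlgebraicGeometry.Resolution
open Scheme.IdealSheafData

namespace Summit.ResolutionOfSingularities.ResolutionOfSingularities.Theorems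

universe u

namespace DepthLegal

/-! ## §1 Transport tools -/

variable {W W' : Scheme.{u}}

/-- **Weight-two controlled transform of a product of two ideals each contained in the centre**:
`τᶜ(A·B, 2) = τᶜ(A, 1) · τᶜ(B, 1)` for `A, B ≤ C` (`τ^*A = 𝓘_exc·τᶜ(A,1)`, `τ^*B = 𝓘_exc·τᶜ(B,1)`, cancel `𝓘_exc²`).
[cite: BierstoneGrigorievMilmanWlodarczyk2011, §3.2 Lemma 3.2.1] -/
theorem controlledTransform_mul_two {τ : W' ⟶ W} {C A B : W.IdealSheafData} (hτ : IsBlowup τ C)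
    (hA : A ≤ C) (hB : B ≤ C) :
    controlledTransform τ C (A * B) 2 = controlledTransform τ C A 1 * controlledTransform τ C B 1 := by
  have hD := hτ.isEffectiveCartier
  have hA' : A.comap τ ≤ C.comap τ ^ 1 := by
    have h : A.comap τ ≤ (C ^ 1).comap τ := Scheme.IdealSheafData.comap_mono (f := τ) (by simpa using hA)
    rwa [comap_pow] at h
  have hB' : B.comap τ ≤ C.comap τ ^ 1 := by
    have h : B.comap τ ≤ (C ^ 1).comap τ := Scheme.IdealSheafData.comap_mono (f := τ) (by simpa using hB)
    rwa [comap_pow] at h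
  have eA := hτ.pow_mul_controlledTransform_eq hA'
  have eB := hτ.pow_mul_controlledTransform_eq hB'
  refine colon_pow_eq_of_mul_eq hD ?_
  rw [comap_mul, ← eA, ← eB]
  ring

/-- **L2 — legality by order**: on a regular locally Noetherian scheme, an ideal contained in the product of the ideals of two
closed sets each containing the regular centre `V(C)` has order `≥ 2` at every (scheme) point of the centre, hence lies in `𝓘_C²`.
[cite: CossartJannsenSaito2020, Def. 6.23 (2)] [cite: BierstoneGrigorievMilmanWlodarczyk2011, §3.1] -/
theorem le_sq_of_le_mul_vanishingIdeal [IsLocallyNoetherian W] (hW : Scheme.IsRegular W)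
    {H C : W.IdealSheafData} (hC : Scheme.IsRegular C.subscheme) {S T : Closeds W}
    (hle : H ≤ vanishingIdeal S * vanishingIdeal T)
    (hS : (C.support : Set W) ⊆ S) (hT : (C.support : Set W) ⊆ T) : H ≤ C ^ 2 := by
  refine le_pow_of_isRegular_subscheme_of_forall_le_idealOrder_of_isRegular hW hC fun y hy => ?_
  rw [le_idealOrder_iff]
  have hyS : y ∈ (vanishingIdeal S).support := by
    rw [← SetLike.mem_coe, Scheme.IdealSheafData.coe_support_vanishingIdeal]; exact hS hy
  have hyT : y ∈ (vanishingIdeal T).support := by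
    rw [← SetLike.mem_coe, Scheme.IdealSheafData.coe_support_vanishingIdeal]; exact hT hy
  have h1 : stalkIdeal (vanishingIdeal S) y ≤ maximalIdeal _ := (mem_support_iff_stalkIdeal_le _ y).mp hyS
  have h2 : stalkIdeal (vanishingIdeal T) y ≤ maximalIdeal _ := (mem_support_iff_stalkIdeal_le _ y).mp hyT
  calc stalkIdeal H y ≤ stalkIdeal (vanishingIdeal S * vanishingIdeal T) y := stalkIdeal_mono hle y
    _ = stalkIdeal (vanishingIdeal S) y * stalkIdeal (vanishingIdeal T) y := stalkIdeal_mul _ _ y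
    _ ≤ maximalIdeal _ * maximalIdeal _ := Ideal.mul_mono h1 h2
    _ = maximalIdeal _ ^ 2 := (pow_two _).symm

/-! ## §2 The weight-two transport along an old-boundary-permissible sequence -/

/-- **WEIGHT-TWO TRANSPORT ALONG AN OLD-BOUNDARY-PERMISSIBLE SEQUENCE** (see the module docstring): starting from an effective
Cartier `H ≤ 𝓘(X) · 𝓘(B)` on an integral Noetherian regular excellent threefold at the end of a pure weight-two sequence, every
`IsOBPermissibleSequence X B σ X' Bold' B'` is matched by a pure weight-two sequence along the SAME centres (all flag-legal by L2),
ending at an effective Cartier `H' ≤ 𝓘(closure X') · 𝓘(closure Bold')` with `Supp H' ⊆ σ⁻¹(Supp H)`, on an integral Noetherian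
regular excellent threefold. [cite: CossartJannsenSaito2020, Cor. 6.26, Def. 6.23 (2)]
[cite: BierstoneGrigorievMilmanWlodarczyk2011, §3.2 Lemma 3.2.1] [cite: Kollar2007, 3.30.2] -/
theorem oldBoundary_transport
    {E₀ E : Scheme.{u}} [IsIntegral E] [IsNoetherian E] (hE : Scheme.IsRegular E) (hexc : Scheme.IsExcellent E)
    (hdim : topologicalKrullDim E = 3) {ρ : E ⟶ E₀} {H₀ : E₀.IdealSheafData} {H : E.IdealSheafData}
    (hseq : DepthTargets.IsPureWeightedSeq 2 ρ H₀ H) (hH : IsEffectiveCartier H)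
    {X B : Set E} (hX : IsClosed X) (hB : IsClosed B)
    (hle : H ≤ vanishingIdeal ⟨X, hX⟩ * vanishingIdeal ⟨B, hB⟩) :
    ∀ {Z' : Scheme.{u}} {σ : Z' ⟶ E} {X' Bold' B' : Set Z'}, IsOBPermissibleSequence X B σ X' Bold' B' →
      IsIntegral Z' ∧ IsNoetherian Z' ∧ Scheme.IsRegular Z' ∧ Scheme.IsExcellent Z' ∧ topologicalKrullDim Z' = 3 ∧
      ∃ H' : Z'.IdealSheafData, DepthTargets.IsPureWeightedSeq 2 (σ ≫ ρ) H₀ H' ∧ IsEffectiveCartier H' ∧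
        H' ≤ vanishingIdeal ⟨closure X', isClosed_closure⟩ * vanishingIdeal ⟨closure Bold', isClosed_closure⟩ ∧
        (H'.support : Set Z') ⊆ σ ⁻¹' (H.support : Set E) := by
  intro Z' σ X' Bold' B' h
  induction h with
  | refl =>
    have hXX : (⟨closure X, isClosed_closure⟩ : Closeds E) = ⟨X, hX⟩ := Closeds.ext hX.closure_eq
    have hBB : (⟨closure B, isClosed_closure⟩ : Closeds E) = ⟨B, hB⟩ := Closeds.ext hB.closure_eq
    refine ⟨inferInstance, inferInstance, hE, hexc, hdim, H, by simpa using hseq, hH, by rw [hXX, hBB]; exact hle,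
      fun x hx => by simpa using hx⟩
  | @blowup Z' Z'' σ X' Bold' B' h C τ hτ hreg hsub hold hperm hnc ih =>
    obtain ⟨hint, hnoeth, hZ', hexc', hdim', H₁, hseq₁, hH₁, hle₁, hsupp₁⟩ := ih
    haveI := hint
    haveI := hnoeth
    set A := vanishingIdeal (⟨closure X', isClosed_closure⟩ : Closeds Z') with hA
    set Bv := vanishingIdeal (⟨closure Bold', isClosed_closure⟩ : Closeds Z') with hBv
    -- the centre lies on `closure X'` and on `closure Bold'`
    have hCX : (C.support : Set Z') ⊆ closure X' := by
      intro x hx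
      have hx' : x ∈ ((vanishingIdeal (⟨closure X', isClosed_closure⟩ : Closeds Z')).support : Set Z') :=
        Scheme.IdealSheafData.support_antitone hsub hx
      rwa [Scheme.IdealSheafData.coe_support_vanishingIdeal] at hx'
    have hCB : (C.support : Set Z') ⊆ closure Bold' := fun x hx => subset_closure (hold x hx)
    -- L2: legality of the centre
    have hlegal : H₁ ≤ C ^ 2 := le_sq_of_le_mul_vanishingIdeal hZ' hreg hle₁ hCX hCB
    -- the centre is non-zero
    have hCne : C ≠ ⊥ := by
      intro hC0
      have hC2 : C ^ 2 = ⊥ := by rw [hC0, pow_two, Scheme.IdealSheafData.mul_bot]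
      have h0 : H₁ = ⊥ := le_bot_iff.mp (hC2 ▸ hlegal)
      obtain ⟨U, hxU, g, hg, hU⟩ := hH₁ (Classical.arbitrary Z')
      rw [h0, Scheme.IdealSheafData.ideal_bot, Pi.bot_apply, eq_comm, Ideal.span_singleton_eq_bot] at hU
      subst hU
      haveI : Nonempty (U : Z'.Opens) := ⟨⟨_, hxU⟩⟩
      exact zero_notMem_nonZeroDivisors hg
    haveI : IsIntegral Z'' := hτ.isIntegral hCne
    haveI : IsNoetherian Z'' := isNoetherian_of_isBlowup hτ
    have hZ'' : Scheme.IsRegular Z'' := IsBlowup.isRegular_of_isRegular_subscheme hZ' hreg hτ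
    have hexc'' : Scheme.IsExcellent Z'' := hτ.isExcellent hexc'
    have hdim'' : topologicalKrullDim Z'' = 3 := by
      haveI := hτ.isProper
      rw [← hdim']
      exact (IsModification.of_isBlowup hτ hCne).isBirational.topologicalKrullDim_eq_of_isProper
    -- the new state
    set H₂ := controlledTransform τ C H₁ 2 with hH₂
    have hcomap : H₁.comap τ ≤ C.comap τ ^ 2 := by
      have h' : H₁.comap τ ≤ (C ^ 2).comap τ := Scheme.IdealSheafData.comap_mono (f := τ) hlegal
      rwa [comap_pow] at h'
    have heq : H₁.comap τ = C.comap τ ^ 2 * H₂ := (hτ.pow_mul_controlledTransform_eq hcomap).symm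
    -- `𝓘(closure Bold') ≤ C` and `𝓘(closure X') ≤ C`
    have hBvC : Bv ≤ C := by
      rw [eq_vanishingIdeal_support_of_isRegular C hreg]
      exact vanishingIdeal_antimono (show (C.support : Closeds Z') ≤ ⟨closure Bold', isClosed_closure⟩ from hCB)
    -- the transported bound
    set I₂X := vanishingIdeal (⟨closure (closure (τ ⁻¹' (X' \ (C.support : Set Z')))), isClosed_closure⟩ : Closeds Z'')
      with hI₂X
    set I₂B := vanishingIdeal (⟨closure (closure (τ ⁻¹' (Bold' \ (C.support : Set Z')))), isClosed_closure⟩ :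
      Closeds Z'') with hI₂B
    have hI₂X' : I₂X = vanishingIdeal ⟨closure (τ ⁻¹' (X' \ (C.support : Set Z'))), isClosed_closure⟩ := by
      rw [hI₂X]; congr 1; exact Closeds.ext closure_closure
    have hI₂B' : I₂B = vanishingIdeal ⟨closure (τ ⁻¹' (Bold' \ (C.support : Set Z'))), isClosed_closure⟩ := by
      rw [hI₂B]; congr 1; exact Closeds.ext closure_closure
    have hle₂ : H₂ ≤ I₂X * I₂B := by
      calc H₂ ≤ controlledTransform τ C (A * Bv) 2 := colon_mono_left (Scheme.IdealSheafData.comap_mono (f := τ) hle₁) _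
        _ = controlledTransform τ C A 1 * controlledTransform τ C Bv 1 := controlledTransform_mul_two hτ hsub hBvC
        _ ≤ I₂X * I₂B := by
          rw [hI₂X', hI₂B']
          exact mul_le_mul' (DepthFlagCJS.controlledTransform_one_le_vanishingIdeal hτ X')
            (DepthFlagCJS.controlledTransform_one_le_vanishingIdeal hτ Bold')
    -- supports
    have hsupp₂ : (H₂.support : Set Z'') ⊆ (τ ≫ σ) ⁻¹' (H.support : Set E) := by
      intro y hy
      have hy' : y ∈ ((H₁.comap τ).support : Set Z'') :=
        Scheme.IdealSheafData.support_antitone (comap_le_controlledTransform τ C H₁ 2) hy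
      rw [Scheme.IdealSheafData.support_comap] at hy'
      have : τ y ∈ (H₁.support : Set Z') := hy'
      have := hsupp₁ this
      simpa [Set.mem_preimage, Scheme.Hom.comp_base] using this
    refine ⟨inferInstance, inferInstance, hZ'', hexc'', hdim'', H₂, ?_,
      hτ.isEffectiveCartier_controlledTransform_of_le_pow hH₁ hlegal, hle₂, hsupp₂⟩
    rw [Category.assoc]
    exact .cons τ (σ ≫ ρ) H₀ H₁ H₂ C hseq₁ hreg hlegal hτ heq

/-! ## §3 The phase-2 closer (content form of `LegalPhaseTwo₃`, modulo the binder) -/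

/-- **PHASE 2 of the residual CLOSED modulo `OldBoundaryResolution₃`** (content form of idea-1's `LegalPhaseTwo₃`, ONE-IDEAL
currency): from `HostBoundary₃`-data `H = D · M` on an integral Noetherian regular excellent threefold — `D` an effective Cartier
divisor with `V(D)` regular, `Supp M` inside a strict normal crossings divisor `B` containing no codimension-one point of `Supp D`,
`H ≠ ⊥` locally principal — there is a pure weight-two sequence `π : E' ⟶ E`, `IsPureWeightedSeq 2 π H H'`, with `E'` an integral
Noetherian regular excellent threefold, `H' ≠ ⊥` locally principal, and `Supp H'` inside a strict normal crossings divisor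
(`SncSupport`).  The binder is fed the old boundary `Supp M` (snc: de Jong 4.9), so that every centre point carries the host and a
positive-coefficient component — L2. [cite: CossartJannsenSaito2020, Thm. 1.4, Cor. 6.26] [cite: DeJong1996, 4.9]
[cite: Kollar2007, 3.30.2] -/
theorem phaseTwo_sncSupport_of_oldBoundary (hOB : OldBoundaryResolution₃.{u})
    {E : Scheme.{u}} [IsIntegral E] [IsNoetherian E] (hE : Scheme.IsRegular E) (hexc : Scheme.IsExcellent E)
    (hdim : topologicalKrullDim E = 3) {H D M : E.IdealSheafData} {B : Set E}
    (hH0 : H ≠ ⊥) (hHlp : IsLocallyPrincipal H) (hfac : H = D * M) (hD : IsEffectiveCartier D)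
    (hDreg : Scheme.IsRegular D.subscheme) (hBsnc : IsStrictNormalCrossingsDivisor E B)
    (hMB : (M.support : Set E) ⊆ B) (hcoh : ∀ x ∈ D.support, x ∈ B → 1 < Order.coheight x) :
    ∃ (E' : Scheme.{u}) (π : E' ⟶ E) (H' : E'.IdealSheafData),
      DepthTargets.IsPureWeightedSeq 2 π H H' ∧ IsIntegral E' ∧ IsNoetherian E' ∧ Scheme.IsRegular E' ∧
      Scheme.IsExcellent E' ∧ topologicalKrullDim E' = 3 ∧ H' ≠ ⊥ ∧ IsLocallyPrincipal H' ∧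
      ∃ B' : Set E', IsStrictNormalCrossingsDivisor E' B' ∧ (H'.support : Set E') ⊆ B' := by
  have hHc : IsEffectiveCartier H := hHlp.isEffectiveCartier_of_ne_bot hH0
  have hMc : IsEffectiveCartier M := (hfac ▸ hHc).of_mul_right
  -- the old boundary is the support of `M`: a Cartier divisor inside the snc divisor `B`, hence snc (de Jong 4.9)
  have hOsnc : IsStrictNormalCrossingsDivisor E (M.support : Set E) :=
    hBsnc.of_subset_of_isEffectiveCartier hMB hMc rfl
  obtain ⟨E₁, π, X₁, Bold₁, B₁, hseqOB, hsnc, htot⟩ :=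
    hOB E hE hexc hdim D (M.support : Set E) hD hDreg hOsnc (fun x hx hxM => hcoh x hx (hMB hxM))
  have hXc : IsClosed (D.support : Set E) := D.support.isClosed
  have hBc : IsClosed (M.support : Set E) := M.support.isClosed
  have hle : H ≤ vanishingIdeal ⟨(D.support : Set E), hXc⟩ * vanishingIdeal ⟨(M.support : Set E), hBc⟩ := by
    rw [hfac]
    exact mul_le_mul' (Scheme.IdealSheafData.le_support_iff_le_vanishingIdeal.mp le_rfl)
      (Scheme.IdealSheafData.le_support_iff_le_vanishingIdeal.mp le_rfl)
  obtain ⟨hint, hnoeth, hreg₁, hexc₁, hdim₁, H', hseq', hH'c, -, hsupp'⟩ :=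
    oldBoundary_transport hE hexc hdim (.nil H) hHc hXc hBc hle hseqOB
  haveI := hint
  haveI := hnoeth
  have hH'0 : H' ≠ ⊥ := by
    intro h0
    obtain ⟨U, hxU, g, hg, hU⟩ := hH'c (Classical.arbitrary E₁)
    rw [h0, Scheme.IdealSheafData.ideal_bot, Pi.bot_apply, eq_comm, Ideal.span_singleton_eq_bot] at hU
    subst hU
    haveI : Nonempty (U : E₁.Opens) := ⟨⟨_, hxU⟩⟩
    exact zero_notMem_nonZeroDivisors hg
  refine ⟨E₁, π, H', by simpa using hseq', hint, hnoeth, hreg₁, hexc₁, hdim₁, hH'0, hH'c.isLocallyPrincipal,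
    X₁ ∪ B₁, hsnc, ?_⟩
  rw [← htot]
  refine hsupp'.trans (Set.preimage_mono ?_)
  intro x hx
  rw [hfac] at hx
  have hx' : x ∈ (D * M).support := hx
  rw [Scheme.IdealSheafData.support_mul] at hx'
  rcases hx' with hx' | hx'
  · exact Or.inl hx'
  · exact Or.inr hx'

/-- **The same in FLAG currency** (diagonal conversion by `IsFlagSeq.of_isPureWeightedSeq`): the phase-2 output as an
`IsFlagSeq π H H H' H'` with `FlagState₃`-type clauses and an snc divisor containing `Supp H'` — the input shape of
res-L1-w52-lead-1's `DepthLegal.legalSeparation₃` (PHASE 3, p529695). [cite: Kollar2007, 3.30.2] -/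
theorem phaseTwo_isFlagSeq_of_oldBoundary (hOB : OldBoundaryResolution₃.{u})
    {E : Scheme.{u}} [IsIntegral E] [IsNoetherian E] (hE : Scheme.IsRegular E) (hexc : Scheme.IsExcellent E)
    (hdim : topologicalKrullDim E = 3) {H D M : E.IdealSheafData} {B : Set E}
    (hH0 : H ≠ ⊥) (hHlp : IsLocallyPrincipal H) (hfac : H = D * M) (hD : IsEffectiveCartier D)
    (hDreg : Scheme.IsRegular D.subscheme) (hBsnc : IsStrictNormalCrossingsDivisor E B)
    (hMB : (M.support : Set E) ⊆ B) (hcoh : ∀ x ∈ D.support, x ∈ B → 1 < Order.coheight x) :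
    ∃ (E' : Scheme.{u}) (π : E' ⟶ E) (H' : E'.IdealSheafData),
      DepthTargets.IsFlagSeq π H H H' H' ∧ IsIntegral E' ∧ IsNoetherian E' ∧ Scheme.IsRegular E' ∧
      Scheme.IsExcellent E' ∧ topologicalKrullDim E' = 3 ∧ H' ≠ ⊥ ∧ IsLocallyPrincipal H' ∧
      ∃ B' : Set E', IsStrictNormalCrossingsDivisor E' B' ∧ (H'.support : Set E') ⊆ B' := by
  obtain ⟨E', π, H', hseq, h⟩ := phaseTwo_sncSupport_of_oldBoundary hOB hE hexc hdim hH0 hHlp hfac hD hDreg hBsnc hMB hcoh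
  exact ⟨E', π, H', DepthTargets.IsFlagSeq.of_isPureWeightedSeq hseq, h⟩

/-! ## §4 From res-D-pv-054's `StateIn` currency (idea-1's `HostBoundary₃` rev 3) -/

/-- **No host component inside the boundary, in coheight form**: for a state `StateIn 𝔟 D ℬ 𝒟` on an integral locally
Noetherian scheme, a point of `Supp D` lying on a boundary member has coheight `> 1` — a coheight-`≤ 1` point of
`Supp D ∩ Supp F` would be the generic point of the irreducible Cartier support `Supp F` (or of the whole scheme), forcing
`Supp F ⊆ Supp D`, excluded by the `free` clause. [folklore] [cite: StacksProject, Tag 02IZ] -/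
theorem one_lt_coheight_of_stateIn {W : Scheme.{u}} [IsIntegral W] [IsLocallyNoetherian W] {𝔟 D : W.IdealSheafData}
    {ℬ 𝒟 : List (W.IdealSheafData × ℕ)} (S : WeightTwoB.StateIn 𝔟 D ℬ 𝒟) {x : W} (hxD : x ∈ D.support)
    {p : W.IdealSheafData × ℕ} (hp : p ∈ ℬ) (hxp : x ∈ p.1.support) : 1 < Order.coheight x := by
  by_contra hle
  rw [not_lt] at hle
  have hirr : IsIrreducible (p.1.support : Set W) := S.irred p hp
  have hFc : IsEffectiveCartier p.1 :=
    S.isEffectiveCartier_of_mem (show p.1 ∈ boundaryOf ℬ from List.mem_map.mpr ⟨p, hp, rfl⟩)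
  have hgen : IsGenericPoint hirr.genericPoint (p.1.support : Set W) :=
    hirr.isGenericPoint_genericPoint p.1.support.isClosed
  set η := hirr.genericPoint with hη
  have hηx : η ⤳ x := hgen.specializes hxp
  have hfin : Order.coheight x ≠ ⊤ := ne_top_of_le_ne_top (by decide) hle
  by_cases hcmp : Order.coheight x ≤ Order.coheight η
  · -- `η = x`: the member's support is `closure {x} ⊆ Supp D`
    have hηeq : η = x := eq_of_specializes_of_coheight_le hηx hfin hcmp
    refine S.free p hp ?_
    rw [← hgen.def, hηeq]
    exact closure_minimal (Set.singleton_subset_iff.mpr hxD) D.support.isClosed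
  · -- `coheight η = 0`: `η` is the generic point of `W`, which is not on the support of the Cartier divisor `p.1`
    have h0 : Order.coheight η = 0 := by
      have hlt : Order.coheight η < 1 := lt_of_lt_of_le (not_le.mp hcmp) hle
      exact Order.lt_one_iff.mp hlt
    have hηgen : η = genericPoint W := eq_genericPoint_of_coheight_eq_zero h0
    exact DeJong1996.NormalProjectivePair.genericPoint_notMem_support hFc (hηgen ▸ hgen.mem)

/-- **PHASE 2 from a `StateIn` host × boundary state** (= the body of idea-1's `HostBoundary₃`, Φ rev 3): the snc boundary SET is
the union of the supports of the boundary sheaves (`HasSNC.isStrictNormalCrossingsDivisor_biUnion_support`), `M = monomialIdeal ℬ`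
is supported on it, and no host component lies in it (`one_lt_coheight_of_stateIn`). [cite: CossartJannsenSaito2020, Thm. 1.4]
[cite: BierstoneGrigorievMilmanWlodarczyk2011, Def. 3.1.1] -/
theorem phaseTwo_sncSupport_of_stateIn (hOB : OldBoundaryResolution₃.{u})
    {E : Scheme.{u}} [IsIntegral E] [IsNoetherian E] (hE : Scheme.IsRegular E) (hexc : Scheme.IsExcellent E)
    (hdim : topologicalKrullDim E = 3) {H D : E.IdealSheafData} {ℬ : List (E.IdealSheafData × ℕ)}
    (hH0 : H ≠ ⊥) (hHlp : IsLocallyPrincipal H) (S : WeightTwoB.StateIn H D ℬ []) (hDreg : Scheme.IsRegular D.subscheme) :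
    ∃ (E' : Scheme.{u}) (π : E' ⟶ E) (H' : E'.IdealSheafData),
      DepthTargets.IsPureWeightedSeq 2 π H H' ∧ IsIntegral E' ∧ IsNoetherian E' ∧ Scheme.IsRegular E' ∧
      Scheme.IsExcellent E' ∧ topologicalKrullDim E' = 3 ∧ H' ≠ ⊥ ∧ IsLocallyPrincipal H' ∧
      ∃ B' : Set E', IsStrictNormalCrossingsDivisor E' B' ∧ (H'.support : Set E') ⊆ B' := by
  have hBsnc : IsStrictNormalCrossingsDivisor E (⋃ F ∈ boundaryOf ℬ, (F.support : Set E)) :=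
    S.sncB.isStrictNormalCrossingsDivisor_biUnion_support
  have hMB : ((monomialIdeal ℬ).support : Set E) ⊆ ⋃ F ∈ boundaryOf ℬ, (F.support : Set E) := by
    refine (DepthSep.support_monomialIdeal_subset ℬ).trans ?_
    intro x hx
    simp only [Set.mem_iUnion] at hx ⊢
    obtain ⟨p, hp, hxp⟩ := hx
    exact ⟨p.1, List.mem_map.mpr ⟨p, hp, rfl⟩, hxp⟩
  have hcoh : ∀ x ∈ D.support, x ∈ (⋃ F ∈ boundaryOf ℬ, (F.support : Set E)) → 1 < Order.coheight x := by
    intro x hxD hxB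
    simp only [Set.mem_iUnion] at hxB
    obtain ⟨F, hF, hxF⟩ := hxB
    obtain ⟨p, hp, rfl⟩ := List.mem_map.mp hF
    exact one_lt_coheight_of_stateIn S hxD hp hxF
  exact phaseTwo_sncSupport_of_oldBoundary hOB hE hexc hdim hH0 hHlp S.fac S.hostCartier hDreg hBsnc hMB hcoh

end DepthLegal

end Summit.ResolutionOfSingularities.ResolutionOfSingularities.Theorems

end
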